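import Summits.ABC.ABC.Theses.IsogenyGlueCongruence

/-!
# `PolyHeightOfBoundedPrimes` (stmt-ABC-16006, crux B′) — line `Sketch` (card `archimedean-hall-split`):
the proved glue and the registered TRANSFER stub

Crux `B′ = A → H` of route IsogenyGlueCongruence (`H`: `max(|Δ_W|, |c₄(W)|³) ≤ C·N_W^σ` on semistable
global minimal elliptic `W/ℚ`). The line splits `H` along finite / archimedean places into
`PolySzpiroΔ` (`|Δ_W| ≤ C·N_W^σ`) and `PolyHallΔ` (`|c₄(W)|³ ≤ C·|Δ_W|^{σ'}`, `0 ≤ σ'`). This file lands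

* `polyHeight_of_split` — both halves ⟹ `H` (exponent `σ₁⁺ + σ₁⁺σ'`, constant `C₁' + C₂'C₁'^{σ'}`);
* `stub_polyHeightOfBoundedPrimes_of_split` — the REGISTERED transfer stub of the lead's skeleton
  (`Cruxes/PolyHeightOfBoundedPrimes/Lines/Sketch.lean`): `PolySzpiroΔ → PolyHallΔ → PolyHeightOfBoundedPrimes`
  (the composition minus its two conjecture-grade cores; hypothesis `A` idle);
* `of_split` — the same, uncurried on the conjunction.

The converse `H → PolySzpiroΔ ∧ PolyHallΔ` is the disprover's landed
`PolyHeightOfBoundedPrimes.Negative.split_of_polyHeight` (p122124), so the transfer target is exactly `H`.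
CONDITIONAL bridge: nothing here closes the item (both halves are open conjectures in print).
-/

noncomputable section

-- single-conjunct summit ABC: the duplicate ABC.ABC is mandated (CONVENTIONS §2)
set_option linter.dupNamespace false

namespace Summit.ABC.ABC.Theorems.PolyHeightOfBoundedPrimes.HallSplit

open WeierstrassCurve
open Summit.ABC.ABC.Theses.IsogenyGlueCongruence

/-- **Both halves give `H`.** From `|Δ| ≤ C₁N^{σ₁}` and `|c₄|³ ≤ C₂|Δ|^{σ₂}` (`0 ≤ σ₂`):
`max(|Δ|, |c₄|³) ≤ (C₁' + C₂'C₁'^{σ₂}) · N^{σ₁' + σ₁'σ₂}` with `C₁' = max C₁ 1`, `σ₁' = max σ₁ 0`,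
`C₂' = max C₂ 0` (using `1 ≤ N_W`). [folklore] -/
theorem polyHeight_of_split
    (hΔ : ∃ σ C : ℝ, ∀ (W : WeierstrassCurve ℚ) [W.IsElliptic] [W.IsGloballyMinimal]
      [NeZero (W.conductorNorm ℤ)], W.IsSemistable ℤ →
        ((|W.Δ| : ℚ) : ℝ) ≤ C * (W.conductorNorm ℤ : ℝ) ^ σ)
    (hHall : ∃ σ C : ℝ, 0 ≤ σ ∧ ∀ (W : WeierstrassCurve ℚ) [W.IsElliptic] [W.IsGloballyMinimal]
      [NeZero (W.conductorNorm ℤ)], W.IsSemistable ℤ →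
        ((|W.c₄| ^ 3 : ℚ) : ℝ) ≤ C * ((|W.Δ| : ℚ) : ℝ) ^ σ) :
    ∃ σ C : ℝ, ∀ (W : WeierstrassCurve ℚ) [W.IsElliptic] [W.IsGloballyMinimal]
      [NeZero (W.conductorNorm ℤ)], W.IsSemistable ℤ →
        ((max |W.Δ| (|W.c₄| ^ 3) : ℚ) : ℝ) ≤ C * (W.conductorNorm ℤ : ℝ) ^ σ := by
  obtain ⟨σ₁, C₁, h₁⟩ := hΔ
  obtain ⟨σ₂, C₂, hσ₂, h₂⟩ := hHall
  refine ⟨max σ₁ 0 + max σ₁ 0 * σ₂, max C₁ 1 + max C₂ 0 * (max C₁ 1) ^ σ₂, ?_⟩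
  intro W _ _ _ hW
  set C₁' : ℝ := max C₁ 1 with hC₁'
  set σ₁' : ℝ := max σ₁ 0 with hσ₁'
  set C₂' : ℝ := max C₂ 0 with hC₂'
  set N : ℝ := (W.conductorNorm ℤ : ℝ) with hNdef
  have hN : (1 : ℝ) ≤ N := by
    rw [hNdef]; exact_mod_cast Nat.one_le_iff_ne_zero.mpr (NeZero.ne _)
  have hN0 : (0 : ℝ) ≤ N := by linarith
  have hC₁'1 : (1 : ℝ) ≤ C₁' := le_max_right _ _
  have hC₁'0 : (0 : ℝ) ≤ C₁' := by linarith
  have hσ₁'0 : (0 : ℝ) ≤ σ₁' := le_max_right _ _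
  have hC₂'0 : (0 : ℝ) ≤ C₂' := le_max_right _ _
  have hΔ0 : (0 : ℝ) ≤ ((|W.Δ| : ℚ) : ℝ) := by exact_mod_cast abs_nonneg _
  -- finite half
  have eΔ : ((|W.Δ| : ℚ) : ℝ) ≤ C₁' * N ^ σ₁' :=
    calc ((|W.Δ| : ℚ) : ℝ) ≤ C₁ * N ^ σ₁ := h₁ W hW
      _ ≤ C₁' * N ^ σ₁ := mul_le_mul_of_nonneg_right (le_max_left _ _) (Real.rpow_nonneg hN0 _)
      _ ≤ C₁' * N ^ σ₁' :=
        mul_le_mul_of_nonneg_left (Real.rpow_le_rpow_of_exponent_le hN (le_max_left _ _)) hC₁'0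
  -- archimedean half
  have ec : ((|W.c₄| ^ 3 : ℚ) : ℝ) ≤ C₂' * C₁' ^ σ₂ * N ^ (σ₁' * σ₂) :=
    calc ((|W.c₄| ^ 3 : ℚ) : ℝ) ≤ C₂ * ((|W.Δ| : ℚ) : ℝ) ^ σ₂ := h₂ W hW
      _ ≤ C₂' * ((|W.Δ| : ℚ) : ℝ) ^ σ₂ :=
        mul_le_mul_of_nonneg_right (le_max_left _ _) (Real.rpow_nonneg hΔ0 _)
      _ ≤ C₂' * (C₁' * N ^ σ₁') ^ σ₂ :=
        mul_le_mul_of_nonneg_left (Real.rpow_le_rpow hΔ0 eΔ hσ₂) hC₂'0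
      _ = C₂' * C₁' ^ σ₂ * N ^ (σ₁' * σ₂) := by
        rw [Real.mul_rpow hC₁'0 (Real.rpow_nonneg hN0 _), ← Real.rpow_mul hN0]; ring
  have hpow1 : N ^ σ₁' ≤ N ^ (σ₁' + σ₁' * σ₂) :=
    Real.rpow_le_rpow_of_exponent_le hN (by nlinarith)
  have hpow2 : N ^ (σ₁' * σ₂) ≤ N ^ (σ₁' + σ₁' * σ₂) :=
    Real.rpow_le_rpow_of_exponent_le hN (by nlinarith)
  have hK : (0 : ℝ) ≤ C₂' * C₁' ^ σ₂ := mul_nonneg hC₂'0 (Real.rpow_nonneg hC₁'0 _)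
  have hpow0 : (0 : ℝ) ≤ N ^ (σ₁' + σ₁' * σ₂) := Real.rpow_nonneg hN0 _
  rw [Rat.cast_max]
  apply max_le
  · calc ((|W.Δ| : ℚ) : ℝ) ≤ C₁' * N ^ σ₁' := eΔ
      _ ≤ C₁' * N ^ (σ₁' + σ₁' * σ₂) := mul_le_mul_of_nonneg_left hpow1 hC₁'0
      _ ≤ (C₁' + C₂' * C₁' ^ σ₂) * N ^ (σ₁' + σ₁' * σ₂) :=
        mul_le_mul_of_nonneg_right (by linarith) hpow0
  · calc ((|W.c₄| ^ 3 : ℚ) : ℝ) ≤ C₂' * C₁' ^ σ₂ * N ^ (σ₁' * σ₂) := ec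
      _ ≤ C₂' * C₁' ^ σ₂ * N ^ (σ₁' + σ₁' * σ₂) := mul_le_mul_of_nonneg_left hpow2 hK
      _ ≤ (C₁' + C₂' * C₁' ^ σ₂) * N ^ (σ₁' + σ₁' * σ₂) :=
        mul_le_mul_of_nonneg_right (by linarith) hpow0

/-- **TRANSFER STUB (registered on stmt-ABC-16006; line `Sketch`, card archimedean-hall-split):**
`PolySzpiroΔ → PolyHallΔ → PolyHeightOfBoundedPrimes` — the lead's composition minus its two
conjecture-grade cores; hypothesis `A = DegreePrimesPolyBounded` is idle. [folklore] -/
theorem stub_polyHeightOfBoundedPrimes_of_split :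
    (∃ σ C : ℝ, ∀ (W : WeierstrassCurve ℚ) [W.IsElliptic] [W.IsGloballyMinimal]
      [NeZero (W.conductorNorm ℤ)], W.IsSemistable ℤ →
        ((|W.Δ| : ℚ) : ℝ) ≤ C * (W.conductorNorm ℤ : ℝ) ^ σ) →
    (∃ σ C : ℝ, 0 ≤ σ ∧ ∀ (W : WeierstrassCurve ℚ) [W.IsElliptic] [W.IsGloballyMinimal]
      [NeZero (W.conductorNorm ℤ)], W.IsSemistable ℤ →
        ((|W.c₄| ^ 3 : ℚ) : ℝ) ≤ C * ((|W.Δ| : ℚ) : ℝ) ^ σ) →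
    PolyHeightOfBoundedPrimes :=
  fun hΔ hHall _ ↦ polyHeight_of_split hΔ hHall

/-- **`PolySzpiroΔ ∧ PolyHallΔ → B′`**, conjunction form of the transfer. [folklore] -/
theorem of_split
    (h : (∃ σ C : ℝ, ∀ (W : WeierstrassCurve ℚ) [W.IsElliptic] [W.IsGloballyMinimal]
      [NeZero (W.conductorNorm ℤ)], W.IsSemistable ℤ →
        ((|W.Δ| : ℚ) : ℝ) ≤ C * (W.conductorNorm ℤ : ℝ) ^ σ) ∧
    (∃ σ C : ℝ, 0 ≤ σ ∧ ∀ (W : WeierstrassCurve ℚ) [W.IsElliptic] [W.IsGloballyMinimal]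
      [NeZero (W.conductorNorm ℤ)], W.IsSemistable ℤ →
        ((|W.c₄| ^ 3 : ℚ) : ℝ) ≤ C * ((|W.Δ| : ℚ) : ℝ) ^ σ)) :
    PolyHeightOfBoundedPrimes :=
  stub_polyHeightOfBoundedPrimes_of_split h.1 h.2

end Summit.ABC.ABC.Theorems.PolyHeightOfBoundedPrimes.HallSplit

end
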